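import Summits.Ventures.CertifiedManyBodySolver.Rows.TorusCeilingHomSpinTwist
import Literature.MathematicalPhysics.QuantumLattice.HubbardSzSectorMonotone
import Literature.MathematicalPhysics.QuantumLattice.InfVolFermionStateSpinFlip
import HarnessLib

/-!
# Spin-twisted torus ceiling V(a) — the torus engine in an arbitrary sector; the sectors `(N↑, N↓)`; spin exchange

HONEST FRAMING: first certified bounds; not a superconductivity verdict; every number certified or
labelled float.
Parts IV/IX (`homTorusSpinTwist_minEnergyOn_div_ge_of_window_certificate` and its `L × L` / CRT / seam
specialisations) bound the sectors `(N = 2n, S^z = 0)` only.  This file and its sequels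
(`TorusCeilingSectors`, `TorusCeilingSectorRows`) remove that restriction.  Here:

* `torus_minEnergyOn_sector_div_ge_of_local_certificate` — the tree's translation-averaged torus
  engine (`torus_minEnergyOn_div_ge_of_local_certificate`, Han 2020 §3 in the tracial sector ground
  state) with the sector `szSector (2n) 0` turned into a hypothesis: ANY non-trivial translation-invariant
  `A`-invariant subspace `K` (same proof; the three uses of the sector abstracted);
* the sectors `(N↑, N↓) = (a, b)` are the tree's `szSector (a + b) ((a − b)/2)` (non-trivial for
  `a, b ≤ |Λ|`: `Literature.….QuantumChemistry.szSector_upDown_ne_bot`; the species numbers act as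
  `a`, `b`: `Summit.Ventures.CertifiedQuantumChemistry.spinNumber_mulVec_of_mem_upDownSector`, used by
  the sequel);
* `minEnergyOn_szSector_neg_of_relabel_spinSwap`, `relabel_spinSwap_homHubbardSpinMag`,
  `minEnergyOn_homHubbardSpinMag_spinSwap` — the spin exchange `Γ` maps `H_κ = homHubbardSpinMag φ κ t U`
  to `H_{κ̄}` (`κ̄ x i σ = κ x i σ̄`) and the sector `(a, b)` onto `(b, a)`: `E_{κ̄}(b, a) = E_κ(a, b)`
  (Lieb 1989, proof of Thm 1, for species-dependent Peierls phases).

No numerical input; the CAL ceiling-page rows these serve are ED references (certified or labelled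
float) and are not part of this file.
[cite: Han2020Bootstrap, §3] [cite: LiebPRL1989, proof of Theorem 1] [cite: Lieb1994, eq. (1)]
-/

noncomputable section

open Matrix Finset
open Literature.MathematicalPhysics.QuantumLattice
open Literature.MathematicalPhysics.QuantumFieldTheory hiding Site
open Literature.MathematicalPhysics.QuantumManyBody.StateRelaxation
open Literature.Probability.LatticeModels
open HubbardWave0
open scoped ComplexOrder ComplexConjugate

namespace Summit.Ventures.CertifiedManyBodySolver.Rows

/-! ### §1. The translation-averaged torus engine in an arbitrary invariant sector -/

section Engine

variable {d L : ℕ} [NeZero L]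

/-- **Translation-averaged certificate ⇒ sector ground-state energy per site, arbitrary sector.**
The tree's `torus_minEnergyOn_div_ge_of_local_certificate` (Han 2020 §2–3 in the tracial sector
ground state of the periodic box; Bratteli–Robinson II §6.2.4) with the sector `szSector (2n) 0`
replaced by ANY subspace `K ≠ ⊥` of the torus Fock space that is invariant under `A` and under the
translation unitaries `U_v = fockTranslate v` and their adjoints; the constraint observables `Gᵢ` act
as the real scalars `gᵢ` on `K`.  Conclusion: `c − Σₖ ‖aₖ‖ + Σᵢ μᵢ (gᵢ / L^d − νᵢ) ≤ minEnergyOn A K / L^d`.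
Same proof as the tree's engine (the sector enters only through `K ≠ ⊥` and the two invariances); the
`DecidableEq (FermionTorus d L)` instance is a binder (callers may use any). [cite: Han2020Bootstrap, §3] -/
theorem torus_minEnergyOn_sector_div_ge_of_local_certificate [DecidableEq (FermionTorus d L)]
    (A : Matrix (Finset (Orb (FermionTorus d L))) (Finset (Orb (FermionTorus d L))) ℂ)
    (hA : A.IsHermitian) (K : Submodule ℂ (Fock (Orb (FermionTorus d L)))) (hK : K ≠ ⊥)
    (hKA : ∀ ψ ∈ K, A *ᵥ ψ ∈ K)
    (hKT : ∀ v : TorusSite d L, ∀ ψ ∈ K, (fockTranslate v).val *ᵥ ψ ∈ K)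
    (hKT' : ∀ v : TorusSite d L, ∀ ψ ∈ K, (fockTranslate v).valᴴ *ᵥ ψ ∈ K)
    (hAT : ∀ v : TorusSite d L, (fockTranslate v).val * A = A * (fockTranslate v).val)
    (X : Matrix (Finset (Orb (FermionTorus d L))) (Finset (Orb (FermionTorus d L))) ℂ)
    (hsum : ∑ v : TorusSite d L, (fockTranslate v).val * X * (fockTranslate v).valᴴ = A)
    {δ' : Type*} (dens : Finset δ') (μ ν g : δ' → ℝ)
    (D G : δ' → Matrix (Finset (Orb (FermionTorus d L))) (Finset (Orb (FermionTorus d L))) ℂ)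
    (hD : ∀ i ∈ dens, ∑ v : TorusSite d L, (fockTranslate v).val * D i * (fockTranslate v).valᴴ = G i)
    (hGh : ∀ i ∈ dens, (G i).IsHermitian)
    (hG : ∀ i ∈ dens, ∀ ψ ∈ K, G i *ᵥ ψ = ((g i : ℝ) : ℂ) • ψ)
    {m : Type*} [Fintype m] [DecidableEq m] {Λm : Matrix m m ℂ} (hΛ : Λm.PosSemidef)
    (O : m → Matrix (Finset (Orb (FermionTorus d L))) (Finset (Orb (FermionTorus d L))) ℂ)
    {κ : Type*} (s : Finset κ)
    (Xc : κ → Matrix (Finset (Orb (FermionTorus d L))) (Finset (Orb (FermionTorus d L))) ℂ)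
    {ι : Type*} (tt : Finset ι)
    (Us Y : ι → Matrix (Finset (Orb (FermionTorus d L))) (Finset (Orb (FermionTorus d L))) ℂ)
    (hU : ∀ l ∈ tt, Us l * A = A * Us l)
    (hUK : ∀ l ∈ tt, ∀ ψ ∈ K, Us l *ᵥ ψ ∈ K)
    (hUK' : ∀ l ∈ tt, ∀ ψ ∈ K, (Us l)ᴴ *ᵥ ψ ∈ K)
    (hUU : ∀ l ∈ tt, (Us l)ᴴ * Us l = 1)
    {ρ : Type*} (r : Finset ρ)
    (Q Z Z' : ρ → Matrix (Finset (Orb (FermionTorus d L))) (Finset (Orb (FermionTorus d L))) ℂ)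
    (q : ρ → ℝ) (hQh : ∀ i ∈ r, (Q i).IsHermitian)
    (hQ : ∀ i ∈ r, ∀ ψ ∈ K, Q i *ᵥ ψ = ((q i : ℝ) : ℂ) • ψ)
    {γ : Type*} (u : Finset γ)
    (C W : γ → Matrix (Finset (Orb (FermionTorus d L))) (Finset (Orb (FermionTorus d L))) ℂ)
    (hC : ∀ j ∈ u, C j * A = A * C j)
    (hCK : ∀ j ∈ u, ∀ ψ ∈ K, C j *ᵥ ψ ∈ K)
    (hCK' : ∀ j ∈ u, ∀ ψ ∈ K, (C j)ᴴ *ᵥ ψ ∈ K)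
    {δ : Type*} (ah : Finset δ) (dc : δ → ℝ)
    (V : δ → Matrix (Finset (Orb (FermionTorus d L))) (Finset (Orb (FermionTorus d L))) ℂ)
    {κ'' : Type*} (w : Finset κ'') (a : κ'' → ℂ)
    (M : κ'' → Matrix (Finset (Orb (FermionTorus d L))) (Finset (Orb (FermionTorus d L))) ℂ)
    (hM : ∀ k ∈ w, (M k).IsContraction) {c : ℝ}
    (hcert : X - (c : ℂ) • (1 : Matrix (Finset (Orb (FermionTorus d L))) (Finset (Orb (FermionTorus d L))) ℂ) -
        ∑ i ∈ dens, ((μ i : ℝ) : ℂ) • (D i - ((ν i : ℝ) : ℂ) •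
          (1 : Matrix (Finset (Orb (FermionTorus d L))) (Finset (Orb (FermionTorus d L))) ℂ)) =
      gramForm Λm O +
        (∑ k ∈ s, (A * Xc k - Xc k * A) +
          ∑ l ∈ tt, (Us l * Y l * (Us l)ᴴ - Y l) +
          ∑ i ∈ r, (Z i * (Q i - ((q i : ℝ) : ℂ) • 1) + (Q i - ((q i : ℝ) : ℂ) • 1) * Z' i) +
          ∑ j ∈ u, (C j * W j - W j * C j)) +
        (∑ m' ∈ ah, ((dc m' : ℝ) : ℂ) • ((V m')ᴴ - V m') + ∑ k ∈ w, a k • M k)) :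
    c - ∑ k ∈ w, ‖a k‖ + ∑ i ∈ dens, μ i * (g i / (L : ℝ) ^ d - ν i) ≤
      A.minEnergyOn K / (L : ℝ) ^ d := by
  -- the statement is parametric in the instance; work with the order-derived one (tree convention)
  obtain rfl : ‹DecidableEq (FermionTorus d L)› = LinearOrder.toDecidableEq := Subsingleton.elim _ _
  letI instDE : DecidableEq (FermionTorus d L) := LinearOrder.toDecidableEq
  -- the objective with the density constraints folded in
  set X' := X - ∑ i ∈ dens, ((μ i : ℝ) : ℂ) • (D i - ((ν i : ℝ) : ℂ) •
    (1 : Matrix (Finset (Orb (FermionTorus d L))) (Finset (Orb (FermionTorus d L))) ℂ)) with hX'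
  have hcert' : X' - (c : ℂ) • (1 : Matrix (Finset (Orb (FermionTorus d L))) (Finset (Orb (FermionTorus d L))) ℂ) =
      gramForm Λm O +
        (∑ k ∈ s, (A * Xc k - Xc k * A) + ∑ l ∈ tt, (Us l * Y l * (Us l)ᴴ - Y l) +
          ∑ i ∈ r, (Z i * (Q i - ((q i : ℝ) : ℂ) • 1) + (Q i - ((q i : ℝ) : ℂ) • 1) * Z' i) +
          ∑ j ∈ u, (C j * W j - W j * C j)) +
        (∑ m' ∈ ah, ((dc m' : ℝ) : ℂ) • ((V m')ᴴ - V m') + ∑ k ∈ w, a k • M k) := by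
    rw [hX', sub_right_comm]
    exact hcert
  have h := Matrix.re_projState_ge_of_local_certificate hA K hKA hK X' hΛ O s Xc tt Us Y hU hUK hUK'
    hUU r Q Z Z' q hQh hQ u C W hC hCK hCK' ah dc V w a M hM hcert'
  -- evaluation of the objective and of the constraint observables in the tracial state
  set P := A.sectorGroundProj K with hP
  have hPh : P.IsHermitian := sectorGroundProj_isHermitian A K
  have hP2 : P * P = P := sectorGroundProj_mul_self A K
  have hP0 : P ≠ 0 := sectorGroundProj_ne_zero hA K hKA hK
  have hPA : P * A = ((A.minEnergyOn K : ℝ) : ℂ) • P := sectorGroundProj_mul hA K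
  set ω := P.projState with hω
  have hone : ω 1 = 1 := projState_one hPh hP2 hP0
  have hPT : ∀ v : TorusSite d L, P * (fockTranslate v).val = (fockTranslate v).val * P := fun v =>
    sectorGroundProj_commute hA K (hAT v) (hKT v) (hKT' v)
  have hTT : ∀ v : TorusSite d L, (fockTranslate v).valᴴ * (fockTranslate v).val = 1 :=
    fockTranslate_conjTranspose_mul_self
  have hωX : ω X = ((A.minEnergyOn K : ℝ) : ℂ) / (Fintype.card (TorusSite d L) : ℂ) :=
    projState_eq_div_of_sum_conj hPh hP2 hP0 hPA (fun v => (fockTranslate v).val) hPT hTT hsum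
  have hωD : ∀ i ∈ dens, ω (D i) = ((g i : ℝ) : ℂ) / (Fintype.card (TorusSite d L) : ℂ) := by
    intro i hi
    have hPG : P * G i = ((g i : ℝ) : ℂ) • P := by
      have h0 := sectorGroundProj_mul_sub_smul A K (hGh i hi) (hG i hi)
      rw [Matrix.mul_sub, Matrix.mul_smul, Matrix.mul_one, sub_eq_zero] at h0
      exact h0
    exact projState_eq_div_of_sum_conj hPh hP2 hP0 hPG (fun v => (fockTranslate v).val) hPT hTT (hD i hi)
  have hωX' : ω X' = ((A.minEnergyOn K : ℝ) : ℂ) / (Fintype.card (TorusSite d L) : ℂ) -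
      ∑ i ∈ dens, ((μ i : ℝ) : ℂ) * (((g i : ℝ) : ℂ) / (Fintype.card (TorusSite d L) : ℂ) - ((ν i : ℝ) : ℂ)) := by
    rw [hX', map_sub, map_sum, hωX]
    congr 1
    refine Finset.sum_congr rfl fun i hi => ?_
    rw [map_smul, map_sub, map_smul, hone, hωD i hi, smul_eq_mul, smul_eq_mul, mul_one]
  have hre : (ω X').re = A.minEnergyOn K / (L : ℝ) ^ d - ∑ i ∈ dens, μ i * (g i / (L : ℝ) ^ d - ν i) := by
    rw [hωX', card_torusSite]
    have e : ((A.minEnergyOn K : ℝ) : ℂ) / ((L ^ d : ℕ) : ℂ) -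
        ∑ i ∈ dens, ((μ i : ℝ) : ℂ) * (((g i : ℝ) : ℂ) / ((L ^ d : ℕ) : ℂ) - ((ν i : ℝ) : ℂ)) =
        ((A.minEnergyOn K / (L : ℝ) ^ d - ∑ i ∈ dens, μ i * (g i / (L : ℝ) ^ d - ν i) : ℝ) : ℂ) := by
      push_cast
      rfl
    rw [e, Complex.ofReal_re]
  rw [hre] at h
  linarith

end Engine

/-! ### §2. The spin exchange between two Hamiltonians on the sectors `(N, ±M)` -/

section UpDownSector

variable {Λ : Type*} [LinearOrder Λ] [Fintype Λ]

/-- **Spin exchange between two Hamiltonians**: if `Γ H Γ⁻¹ = H'` for the spin exchange `Γ`, then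
`H'.minEnergyOn (szSector N (-M)) = H.minEnergyOn (szSector N M)` (`Γ` maps the unit sphere of
`(N, M)` onto that of `(N, -M)`; the tree's `minEnergyOn_szSector_neg` is the case `H' = H`).
[cite: LiebPRL1989, proof of Theorem 1] -/
theorem minEnergyOn_szSector_neg_of_relabel_spinSwap {H H' : Matrix (Finset (Orb Λ)) (Finset (Orb Λ)) ℂ}
    (hH : relabel (Orb.spinSwap : Orb Λ ≃ Orb Λ) H = H') (N : ℕ) (M : ℝ) :
    H'.minEnergyOn (szSector N (-M)) = H.minEnergyOn (szSector N M) := by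
  have hH' : relabel (Orb.spinSwap : Orb Λ ≃ Orb Λ) H' = H := by
    rw [← hH, relabel_spinSwap_relabel_spinSwap]
  have hfw : ∀ ψ : Fock (Orb Λ), star (relabelVec (Orb.spinSwap : Orb Λ ≃ Orb Λ) ψ) ⬝ᵥ
      H' *ᵥ relabelVec (Orb.spinSwap : Orb Λ ≃ Orb Λ) ψ = star ψ ⬝ᵥ H *ᵥ ψ := fun ψ => by
    conv_lhs => rw [← hH]
    rw [relabel_mulVec_relabelVec, star_relabelVec_dotProduct]
  have hbw : ∀ ψ : Fock (Orb Λ), star (relabelVec (Orb.spinSwap : Orb Λ ≃ Orb Λ) ψ) ⬝ᵥ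
      H *ᵥ relabelVec (Orb.spinSwap : Orb Λ ≃ Orb Λ) ψ = star ψ ⬝ᵥ H' *ᵥ ψ := fun ψ => by
    conv_lhs => rw [← hH']
    rw [relabel_mulVec_relabelVec, star_relabelVec_dotProduct]
  unfold Matrix.minEnergyOn
  congr 1
  ext E
  constructor
  · rintro ⟨φ, hφ, h1, rfl⟩
    exact ⟨relabelVec Orb.spinSwap φ, mem_szSector_relabelVec_spinSwap_of_neg hφ,
      by rw [star_relabelVec_dotProduct, h1], by rw [hbw]⟩
  · rintro ⟨ψ, hψ, h1, rfl⟩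
    exact ⟨relabelVec Orb.spinSwap ψ, mem_szSector_neg_relabelVec_spinSwap hψ,
      by rw [star_relabelVec_dotProduct, h1], by rw [hfw]⟩

end UpDownSector

/-! ### §3. The spin exchange on the spin-twisted tori generated by `φ` -/

section SpinTwistedWindowSectors

variable {d d' N : ℕ} [NeZero N]

/-- **Spin exchange maps `H_κ` to `H_{κ̄}`**, `κ̄ x i σ = κ x i σ̄`: `Γ (homHubbardSpinMag φ A t U) Γ⁻¹ =
homHubbardSpinMag φ (A ∘ swap) t U`. [cite: LiebPRL1989, proof of Theorem 1] [cite: Lieb1994, eq. (1)] -/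
theorem relabel_spinSwap_homHubbardSpinMag (φ : Site d →+ TorusSite d' N)
    (A : TorusSite d' N → Fin d → Fin 2 → Circle) (t U : ℝ) :
    relabel (Orb.spinSwap : Orb (FermionTorus d' N) ≃ Orb (FermionTorus d' N)) (homHubbardSpinMag φ A t U) =
      homHubbardSpinMag φ (fun x i σ => A x i (Equiv.swap (0 : Fin 2) 1 σ)) t U := by
  letI instDE : DecidableEq (FermionTorus d' N) := LinearOrder.toDecidableEq
  unfold homHubbardSpinMag
  rw [map_add, map_smul, map_smul, map_sum, map_sum]
  refine congrArg₂ (fun S T => -(t : ℂ) • S + (U : ℂ) • T) ?_ ?_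
  · refine Finset.sum_congr rfl fun x _ => ?_
    rw [map_sum]
    refine Finset.sum_congr rfl fun i _ => ?_
    rw [map_sum]
    refine Fintype.sum_equiv (Equiv.swap (0 : Fin 2) 1) _ _ fun σ => ?_
    rw [map_add, map_smul, map_smul, map_mul, map_mul, relabel_creation, relabel_annihilation,
      relabel_creation, relabel_annihilation, Orb.spinSwap_orb, Orb.spinSwap_orb]
    simp only [Equiv.swap_apply_self]
  · refine Finset.sum_congr rfl fun y _ => ?_
    exact relabel_spinSwap_numberOp_mul_numberOp y

/-- **`E_{κ̄}(b, a) = E_κ(a, b)`**: the spin exchange carries the sector `(N↑, N↓) = (a, b)` of `H_κ` onto the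
sector `(b, a)` of `H_{κ̄}`. [cite: LiebPRL1989, proof of Theorem 1] -/
theorem minEnergyOn_homHubbardSpinMag_spinSwap (φ : Site d →+ TorusSite d' N)
    (A : TorusSite d' N → Fin d → Fin 2 → Circle) (t U : ℝ) (a b : ℕ) :
    (homHubbardSpinMag φ (fun x i σ => A x i (Equiv.swap (0 : Fin 2) 1 σ)) t U).minEnergyOn
        (szSector (b + a) (((b : ℝ) - a) / 2)) =
      (homHubbardSpinMag φ A t U).minEnergyOn (szSector (a + b) (((a : ℝ) - b) / 2)) := by
  rw [add_comm b a, show ((b : ℝ) - a) / 2 = -(((a : ℝ) - b) / 2) by ring]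
  exact minEnergyOn_szSector_neg_of_relabel_spinSwap (relabel_spinSwap_homHubbardSpinMag φ A t U) _ _

end SpinTwistedWindowSectors

end Summit.Ventures.CertifiedManyBodySolver.Rows

end
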